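/-
Copyright (c) 2026 the pub-hodgecm-mathlib formalisation cell (harness21).  Prover seat hodgecm-mathlib-K2Liu-p23 (g3), Track B «K2-LIT»,
#184♮ = hLiu418 = `stmt-HodgeConjecture-24832`; K1-a♮ (Iw-S₀) road (R2′), shared support brick (K1a desk K2Liu-p01 (g11) WORD #7, 2026-09-05T02:17:58Z):
THE SIEGEL MODULUS `|det_Δ ·|^{1∕2}` IS TRIVIAL ON `P_Δ(L⁺_v) ∩ K₀` FOR EVERY COMPACT SUBGROUP `K₀ ≤ H(L⁺_v)`.
KERNEL: theorems only.
-/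
import Summits.HodgeConjecture.HodgeConjecture.Theorems.K2LiuIwasawaHeightLocalModulus   -- ★ (Iw-S₀) FILE A: `modDelta_locToAdelic_sq_eq_absDetDelta`; brings ★ `heightLoc_siegel_mul`, ★ `modDelta_eq_one_of_mem_compact_subgroup`, ★ `siegelDeltaLoc`
import HarnessLib

/-!
# Crux `HLiu418`, K1-a♮ (Iw-S₀) road (R2′): THE SIEGEL MODULUS IS TRIVIAL ON COMPACT SUBGROUPS OF `H(L⁺_v)`

WHAT.  For a finite place `v` of `L⁺`, a subgroup `K₀ ≤ H(L⁺_v) = U(T₀ ⊕ −T₀)(L⁺_v)` with `IsCompact (K₀ : Set _)`, and `p ∈ P_Δ(L⁺_v)` (★ `siegelDeltaLoc v`)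
with `p ∈ K₀`:

* §1 `modDelta_locToAdelic_eq_one_of_mem_compact`: `|det_Δ (ι_v p)|_𝔸^{1∕2} = modDelta (locToAdelic v p) = 1` — the adelic lemma ★ `modDelta_eq_one_of_mem_compact_subgroup`
  (K2LiuIwasawaDeltaUnimodular: a positive real all of whose integer powers are values of a continuous `P_Δ`-height on a compact set is `1`) applied to the
  compact subgroup `ι_v(K₀) ≤ H(𝔸)` (★ `continuous_inclPlaceAdelic`), `ι_v p ∈ P_Δ(𝔸)` by ★ `mem_siegelDeltaLoc_iff`; also in the Lagrangian phrasing of the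
  GR91 local package (`LocalSplitting.IsSiegelDelta`, ★ `mem_siegelDeltaLoc_iff_local`) used by ★ `K2LiuKindOneSingularLocalFace` and the (Iw-S₀) FILES B∕C,
  and for the hyperspecial subgroup `H(𝒪_v)` (★ `isCompact_localInt`).
* §2 `absDetDelta_eq_one_of_mem_compact`: `|det_Δ p|_v = ∏_{w∣v} ‖det_Δ p_w‖_w = 1` (★ FILE A `modDelta_locToAdelic_sq_eq_absDetDelta`).
* §3 `heightLoc_siegel_mul_of_mem_compact`: the local Iwasawa height `H_{𝒦,v}(u) := modDelta (𝒦.pPart (ι_v u))` of ANY Iwasawa datum `𝒦` satisfies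
  `H_{𝒦,v}(p u) = H_{𝒦,v}(u)` for `p ∈ P_Δ(L⁺_v) ∩ K₀` (★ `heightLoc_siegel_mul`) — the restricted Siegel law (f2ᴷ) of the (Iw-S₀) FILE B
  `exists_localFace_kindOneSingular_monomial` for `Hf := H_{𝒦,v}`, in its exact binder shape `∀ p, IsSiegelDelta … p → p ∈ K₀ → ∀ u, Hf (p * u) = Hf u`.

WHY (K1a desk WORD #7).  FILE C docks FILE B at `Hf := H_𝒦 ∘ ι_v` and K2E5-p16's Λ-§ reads (f2‴) the same way; both discharge the restricted Siegel law by §3 in one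
name.  Mathematically: `p ↦ |det_Δ p|_v^{1∕2}` is a continuous positive character of `P_Δ(L⁺_v)`, so its image of the compact group `P_Δ(L⁺_v) ∩ K₀` is a bounded
subgroup of `(ℝ_{>0}, ·)`, hence trivial [MoeglinWaldspurger1995, I.2.2 ∕ II.1.5; Garrett2018, §3.10; Tan1999, §1].

KERNEL.  Theorems only; no `def`, `instance`, `notation`, `sorry`; default heartbeats.
-/

set_option autoImplicit false
set_option linter.dupNamespace false -- the mandated namespace repeats `HodgeConjecture.HodgeConjecture`

open scoped Matrix
open NumberField IsDedekindDomain
open Literature.NumberTheory.Automorphic Literature.NumberTheory.Automorphic.UnitaryGroup Literature.NumberTheory.GaloisRepresentations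
open Literature.NumberTheory.GelbartRogawski1991 Literature.NumberTheory.GelbartRogawski1991.GRConstruction
open Literature.NumberTheory.GelbartRogawski1991.UnitaryDualPair
open Literature.NumberTheory.K2Lit.SiegelDoubled Literature.NumberTheory.K2Lit.LocalSiegelDoubled
open Summit.HodgeConjecture.HodgeConjecture.Cruxes.HLiu418.K2LiuIwasawaDeltaUnimodular
open Summit.HodgeConjecture.HodgeConjecture.Cruxes.HLiu418.K2LiuStdFamilyAwayPurityFlat
open Summit.HodgeConjecture.HodgeConjecture.Cruxes.HLiu418.K2LiuIwasawaHeightLocalModulus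

namespace Summit.HodgeConjecture.HodgeConjecture.Cruxes.HLiu418.K2LiuSiegelModulusCompact

variable (L : Type) [Field L] [NumberField L] [IsCMField L]
variable {N M n : ℕ} (e : Fin N × Fin M ≃ Fin n)
  (dV : Fin N → L) (hdV : ∀ i, IsCMField.complexConj L (dV i) = dV i) (hdV0 : ∀ i, dV i ≠ 0)
  (dW : Fin M → L) (hdW : ∀ i, IsCMField.complexConj L (dW i) = dW i) (hdW0 : ∀ i, dW i ≠ 0)
  (v : HeightOneSpectrum (𝓞 (Fp L)))

/-! ## §1 `modDelta (ι_v p) = 1` on `P_Δ(L⁺_v) ∩ K₀`, `K₀` compact -/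

/-- the image `ι_v(K₀) ≤ H(𝔸)` of a compact subgroup `K₀ ≤ H(L⁺_v)` is compact (★ `continuous_inclPlaceAdelic`). [cite: PlatonovRapinchuk1994, §5.1] -/
theorem isCompact_coe_map_locToAdelic (K₀ : Subgroup (UnitaryGroup.localPi L (IsCMField.complexConj L) (n + n) (hermD L e dV hdV dW hdW) v))
    (hK₀ : IsCompact (K₀ : Set (UnitaryGroup.localPi L (IsCMField.complexConj L) (n + n) (hermD L e dV hdV dW hdW) v))) :
    IsCompact ((K₀.map (locToAdelic L e dV hdV dW hdW v) : Subgroup (HA L e dV hdV dW hdW)) : Set (HA L e dV hdV dW hdW)) := by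
  have hloc : Continuous (locToAdelic L e dV hdV dW hdW v) :=
    UnitaryGroup.continuous_inclPlaceAdelic (Fp L) L (IsCMField.complexConj L) (n + n) (hermD L e dV hdV dW hdW) v
  rw [Subgroup.coe_map]
  exact hK₀.image hloc

include hdV0 hdW0 in
/-- **`|det_Δ (ι_v p)|_𝔸^{1∕2} = 1` for `p ∈ P_Δ(L⁺_v) ∩ K₀`, `K₀ ≤ H(L⁺_v)` a COMPACT subgroup**: ★ `modDelta_eq_one_of_mem_compact_subgroup` for the compact subgroup
`ι_v(K₀) ≤ H(𝔸)`, `ι_v p ∈ P_Δ(𝔸)` (★ `mem_siegelDeltaLoc_iff`). [cite: MoeglinWaldspurger1995, I.2.2] [cite: Garrett2018, §3.10] [cite: Tan1999, §1] -/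
theorem modDelta_locToAdelic_eq_one_of_mem_compact
    (K₀ : Subgroup (UnitaryGroup.localPi L (IsCMField.complexConj L) (n + n) (hermD L e dV hdV dW hdW) v))
    (hK₀ : IsCompact (K₀ : Set (UnitaryGroup.localPi L (IsCMField.complexConj L) (n + n) (hermD L e dV hdV dW hdW) v)))
    {p : UnitaryGroup.localPi L (IsCMField.complexConj L) (n + n) (hermD L e dV hdV dW hdW) v}
    (hp : p ∈ siegelDeltaLoc L e dV hdV dW hdW v) (hpK : p ∈ K₀) :
    modDelta L e dV hdV dW hdW (locToAdelic L e dV hdV dW hdW v p) = 1 :=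
  modDelta_eq_one_of_mem_compact_subgroup L e dV hdV hdV0 dW hdW hdW0 (K₀.map (locToAdelic L e dV hdV dW hdW v))
    (isCompact_coe_map_locToAdelic L e dV hdV dW hdW v K₀ hK₀) (Subgroup.mem_map_of_mem _ hpK)
    ((mem_siegelDeltaLoc_iff L e dV hdV dW hdW v p).1 hp)

include hdV0 hdW0 in
/-- the same in the LAGRANGIAN phrasing of the GR91 local package (`LocalSplitting.IsSiegelDelta` at the δ-package of the K2Lit datum, ★ `mem_siegelDeltaLoc_iff_local`),
the shape of ★ `K2LiuKindOneSingularLocalFace`'s `hIw` and of the (Iw-S₀) FILE B law (f2ᴷ). [cite: MoeglinWaldspurger1995, I.2.2] [cite: Tan1999, §1] -/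
theorem modDelta_locToAdelic_eq_one_of_isSiegelDelta_of_mem_compact
    (K₀ : Subgroup (UnitaryGroup.localPi L (IsCMField.complexConj L) (n + n) (hermD L e dV hdV dW hdW) v))
    (hK₀ : IsCompact (K₀ : Set (UnitaryGroup.localPi L (IsCMField.complexConj L) (n + n) (hermD L e dV hdV dW hdW) v)))
    {p : UnitaryGroup.localPi L (IsCMField.complexConj L) (n + n) (hermD L e dV hdV dW hdW) v}
    (hp : haveI : Algebra.IsQuadraticExtension (Fp L) L := IsCMField.isQuadraticExtension L
      LocalSplitting.IsSiegelDelta (Fp L) L (IsCMField.complexConj L) (complexConj_imagUnit L) (imagUnit_ne_zero L) (imagUnit_mul_self L)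
        v n (gramR_isSymm L e dV hdV dW hdW) (hermD_eq_map_gramD L e dV hdV dW hdW) p)
    (hpK : p ∈ K₀) :
    modDelta L e dV hdV dW hdW (locToAdelic L e dV hdV dW hdW v p) = 1 :=
  modDelta_locToAdelic_eq_one_of_mem_compact L e dV hdV hdV0 dW hdW hdW0 v K₀ hK₀ ((mem_siegelDeltaLoc_iff_local L e dV hdV dW hdW v p).2 hp) hpK

include hdV0 hdW0 in
/-- **hyperspecial case**: `|det_Δ (ι_v p)|_𝔸^{1∕2} = 1` for `p ∈ P_Δ(L⁺_v) ∩ H(𝒪_v)` (★ `isCompact_localInt`). [cite: MoeglinWaldspurger1995, II.1.5] [cite: Tan1999, §1] -/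
theorem modDelta_locToAdelic_eq_one_of_mem_localInt
    {p : UnitaryGroup.localPi L (IsCMField.complexConj L) (n + n) (hermD L e dV hdV dW hdW) v}
    (hp : p ∈ siegelDeltaLoc L e dV hdV dW hdW v) (hpK : p ∈ UnitaryGroup.localInt L (IsCMField.complexConj L) (n + n) (hermD L e dV hdV dW hdW) v) :
    modDelta L e dV hdV dW hdW (locToAdelic L e dV hdV dW hdW v p) = 1 :=
  modDelta_locToAdelic_eq_one_of_mem_compact L e dV hdV hdV0 dW hdW hdW0 v _
    (UnitaryGroup.isCompact_localInt L (IsCMField.complexConj L) (n + n) (hermD L e dV hdV dW hdW) v) hp hpK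

/-! ## §2 `|det_Δ p|_v = 1` on `P_Δ(L⁺_v) ∩ K₀` -/

include hdV0 hdW0 in
/-- **`|det_Δ p|_v = ∏_{w∣v} ‖det_Δ p_w‖_w = 1` for `p ∈ P_Δ(L⁺_v) ∩ K₀`, `K₀` compact** (★ FILE A `modDelta_locToAdelic_sq_eq_absDetDelta` and §1).
[cite: HarrisKudlaSweet1996, §1 (1.15)] [cite: MoeglinWaldspurger1995, I.2.2] -/
theorem absDetDelta_eq_one_of_mem_compact
    (K₀ : Subgroup (UnitaryGroup.localPi L (IsCMField.complexConj L) (n + n) (hermD L e dV hdV dW hdW) v))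
    (hK₀ : IsCompact (K₀ : Set (UnitaryGroup.localPi L (IsCMField.complexConj L) (n + n) (hermD L e dV hdV dW hdW) v)))
    {p : UnitaryGroup.localPi L (IsCMField.complexConj L) (n + n) (hermD L e dV hdV dW hdW) v}
    (hp : p ∈ siegelDeltaLoc L e dV hdV dW hdW v) (hpK : p ∈ K₀) :
    absDetDelta (Fp L) L (IsCMField.complexConj L) v n p = 1 := by
  rw [← modDelta_locToAdelic_sq_eq_absDetDelta L e dV hdV dW hdW v hp,
    modDelta_locToAdelic_eq_one_of_mem_compact L e dV hdV hdV0 dW hdW hdW0 v K₀ hK₀ hp hpK, one_pow]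

include hdV0 hdW0 in
/-- §2 in the Lagrangian phrasing (`LocalSplitting.IsSiegelDelta`, ★ `mem_siegelDeltaLoc_iff_local`). [cite: HarrisKudlaSweet1996, §1 (1.15)] [cite: Tan1999, §1] -/
theorem absDetDelta_eq_one_of_isSiegelDelta_of_mem_compact
    (K₀ : Subgroup (UnitaryGroup.localPi L (IsCMField.complexConj L) (n + n) (hermD L e dV hdV dW hdW) v))
    (hK₀ : IsCompact (K₀ : Set (UnitaryGroup.localPi L (IsCMField.complexConj L) (n + n) (hermD L e dV hdV dW hdW) v)))
    {p : UnitaryGroup.localPi L (IsCMField.complexConj L) (n + n) (hermD L e dV hdV dW hdW) v}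
    (hp : haveI : Algebra.IsQuadraticExtension (Fp L) L := IsCMField.isQuadraticExtension L
      LocalSplitting.IsSiegelDelta (Fp L) L (IsCMField.complexConj L) (complexConj_imagUnit L) (imagUnit_ne_zero L) (imagUnit_mul_self L)
        v n (gramR_isSymm L e dV hdV dW hdW) (hermD_eq_map_gramD L e dV hdV dW hdW) p)
    (hpK : p ∈ K₀) :
    absDetDelta (Fp L) L (IsCMField.complexConj L) v n p = 1 :=
  absDetDelta_eq_one_of_mem_compact L e dV hdV hdV0 dW hdW hdW0 v K₀ hK₀ ((mem_siegelDeltaLoc_iff_local L e dV hdV dW hdW v p).2 hp) hpK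

/-! ## §3 The restricted Siegel law (f2ᴷ) of the local Iwasawa height `H_{𝒦,v} := modDelta (𝒦.pPart (ι_v ·))` -/

include hdV0 hdW0 in
/-- **`H_{𝒦,v}(p u) = H_{𝒦,v}(u)` for `p ∈ P_Δ(L⁺_v) ∩ K₀`, `K₀` compact**, for ANY Iwasawa datum `𝒦` (★ `heightLoc_siegel_mul`: `H_{𝒦,v}(p u) = |det_Δ ι_v p|^{1∕2} H_{𝒦,v}(u)`,
and §1). [cite: Tan1999, §1] [cite: MoeglinWaldspurger1995, I.2.2] -/
theorem heightLoc_siegel_mul_of_mem_compact (𝒦 : IwasawaDatum L e dV hdV dW hdW)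
    (K₀ : Subgroup (UnitaryGroup.localPi L (IsCMField.complexConj L) (n + n) (hermD L e dV hdV dW hdW) v))
    (hK₀ : IsCompact (K₀ : Set (UnitaryGroup.localPi L (IsCMField.complexConj L) (n + n) (hermD L e dV hdV dW hdW) v)))
    {p : UnitaryGroup.localPi L (IsCMField.complexConj L) (n + n) (hermD L e dV hdV dW hdW) v}
    (hp : p ∈ siegelDeltaLoc L e dV hdV dW hdW v) (hpK : p ∈ K₀) (u : UnitaryGroup.localPi L (IsCMField.complexConj L) (n + n) (hermD L e dV hdV dW hdW) v) :
    modDelta L e dV hdV dW hdW (𝒦.pPart (locToAdelic L e dV hdV dW hdW v (p * u))) = modDelta L e dV hdV dW hdW (𝒦.pPart (locToAdelic L e dV hdV dW hdW v u)) := by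
  rw [heightLoc_siegel_mul L e dV hdV hdV0 dW hdW hdW0 v 𝒦 hp u,
    modDelta_locToAdelic_eq_one_of_mem_compact L e dV hdV hdV0 dW hdW hdW0 v K₀ hK₀ hp hpK, one_mul]

include hdV0 hdW0 in
/-- **(f2ᴷ) for `Hf := H_{𝒦,v}`**, in the exact binder shape of the (Iw-S₀) FILE B `exists_localFace_kindOneSingular_monomial`:
`∀ p, IsSiegelDelta … p → p ∈ K₀ → ∀ u, Hf (p * u) = Hf u` (`K₀` compact, `𝒦` any Iwasawa datum). [cite: Tan1999, §1] [cite: MoeglinWaldspurger1995, I.2.2] -/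
theorem heightLoc_siegel_mul_of_isSiegelDelta_of_mem_compact (𝒦 : IwasawaDatum L e dV hdV dW hdW)
    (K₀ : Subgroup (UnitaryGroup.localPi L (IsCMField.complexConj L) (n + n) (hermD L e dV hdV dW hdW) v))
    (hK₀ : IsCompact (K₀ : Set (UnitaryGroup.localPi L (IsCMField.complexConj L) (n + n) (hermD L e dV hdV dW hdW) v))) :
    haveI : Algebra.IsQuadraticExtension (Fp L) L := IsCMField.isQuadraticExtension L
    ∀ p : UnitaryGroup.localPi L (IsCMField.complexConj L) (n + n) (hermD L e dV hdV dW hdW) v,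
      LocalSplitting.IsSiegelDelta (Fp L) L (IsCMField.complexConj L) (complexConj_imagUnit L) (imagUnit_ne_zero L) (imagUnit_mul_self L)
          v n (gramR_isSymm L e dV hdV dW hdW) (hermD_eq_map_gramD L e dV hdV dW hdW) p →
        p ∈ K₀ → ∀ u : UnitaryGroup.localPi L (IsCMField.complexConj L) (n + n) (hermD L e dV hdV dW hdW) v,
          modDelta L e dV hdV dW hdW (𝒦.pPart (locToAdelic L e dV hdV dW hdW v (p * u))) =
            modDelta L e dV hdV dW hdW (𝒦.pPart (locToAdelic L e dV hdV dW hdW v u)) :=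
  fun _ hp hpK u => heightLoc_siegel_mul_of_mem_compact L e dV hdV hdV0 dW hdW hdW0 v 𝒦 K₀ hK₀
    ((mem_siegelDeltaLoc_iff_local L e dV hdV dW hdW v _).2 hp) hpK u

end Summit.HodgeConjecture.HodgeConjecture.Cruxes.HLiu418.K2LiuSiegelModulusCompact
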